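import Summits.HubbardSuperconductivity.HubbardSuperconductivity.Theorems.AnisotropyChordKnnCertificate
import Summits.HubbardSuperconductivity.HubbardSuperconductivity.Theorems.AnisotropyChordKnnAssembly

/-!
# Route `AnisotropyChord` / H0 rotor rung, K_{n,n} sibling of XY-LM₀: INTERVAL certificates in the anisotropy — (S_M) and
# `XYLiebMattisKnn n Δ` on whole `Δ`-intervals from finitely many rational checks
(prover seat `hubbard-h0-rotor-p1` g13; replaces the theory seat's «pencil intervals» (memo ROTOR-THEORY-11 §166) by an exact
convexity-free argument: the block is AFFINE in `η`, `P_M(η) = D + η W_M`)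

Because `knnBlock n M η` is entrywise affine in `η` (`pK_affine`, `cK_affine`), every quadratic form `⟨y, P_M(η) y⟩` is affine
in `η` (`quadForm_knnBlock_affine`), and so is the budget.  Hence two endpoint certificates at `η = a` and `η = b` that SHARE
the test vector (`upperOK` pivots at both ends — valid for every vector; `lowerOK` for the same `v, s` at both ends) prove the
budget condition (S_M) for EVERY real `η ∈ [a, b]` (`budgetCondition_of_endpoints`).  Tables of such interval records
(`ICert`, `icertsOK`, coverage by `reach`) give `XYLiebMattisKnn n Δ` for all `Δ` in a real interval (`xyLiebMattisKnn_of_icertsOK`).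
-/

set_option linter.dupNamespace false
set_option autoImplicit false

open Finset Matrix

namespace Summit.HubbardSuperconductivity.HubbardSuperconductivity.Theorems.AnisotropyChord.Knn

/-! ## Affinity in `η` -/

/-- `p_k` is affine in `η`. [folklore] -/
theorem pK_affine (n : ℕ) (M : ℤ) (a b t : ℝ) (k : ℕ) :
    pK n M (t * a + (1 - t) * b) k = t * pK n M a k + (1 - t) * pK n M b k := by
  unfold pK; ring

/-- `c_k` is linear in `η`. [folklore] -/
theorem cK_affine (n : ℕ) (M : ℤ) (a b t : ℝ) (k : ℕ) :
    cK n M (t * a + (1 - t) * b) k = t * cK n M a k + (1 - t) * cK n M b k := by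
  unfold cK; ring

/-- **the quadratic form of the block is affine in `η`.** [folklore] -/
theorem quadForm_knnBlock_affine (n : ℕ) (M : ℤ) (a b t : ℝ) (y : Fin (numLevels n M) → ℝ) :
    y ⬝ᵥ (knnBlock n M (t * a + (1 - t) * b) *ᵥ y)
      = t * (y ⬝ᵥ (knnBlock n M a *ᵥ y)) + (1 - t) * (y ⬝ᵥ (knnBlock n M b *ᵥ y)) := by
  simp only [knnBlock_eq_jac, jac_quadForm]
  rw [Finset.mul_sum, Finset.mul_sum, ← Finset.sum_add_distrib]
  apply Finset.sum_congr rfl; intro k _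
  rw [pK_affine, cK_affine]; ring

/-- the budget is linear in `η`. [folklore] -/
theorem budget_affine (n M : ℕ) (a b t : ℝ) :
    budget n M (t * a + (1 - t) * b) = t * budget n M a + (1 - t) * budget n M b := by
  unfold budget; ring

/-! ## Unbundled consequences of the point checks -/

/-- UPPER check ⇒ `⟨y, P_M(η) y⟩ ≤ u‖y‖²` for EVERY vector `y`. [folklore] -/
theorem quadForm_le_of_upperOK {n : ℕ} {M : ℤ} {η u : ℚ} (h : upperOK n M η u = true)
    (y : Fin (numLevels n M) → ℝ) : y ⬝ᵥ (knnBlock n M (η : ℝ) *ᵥ y) ≤ (u : ℝ) * (y ⬝ᵥ y) := by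
  rw [knnBlock_eq_jac]
  apply quadForm_le_of_pivots
  intro k hk
  unfold upperOK at h
  rw [List.all_eq_true] at h
  have hk' := h k (List.mem_range.mpr hk)
  rw [decide_eq_true_eq] at hk'
  rw [← cast_pivotQ]
  exact_mod_cast hk'

/-- the real test vector built from a rational list. [folklore] -/
def testVec (m : ℕ) (v : List ℚ) : Fin m → ℝ := fun i => ((vecQ v i : ℚ) : ℝ)

/-- LOWER check ⇒ the test vector is non-zero and `ℓ‖y‖² ≤ ⟨y, P_M(η) y⟩`. [folklore] -/
theorem testVec_of_lowerOK {n : ℕ} {M : ℤ} {η ℓ : ℚ} {v s : List ℚ} (hη : 0 ≤ η)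
    (h : lowerOK n M η ℓ v s = true) :
    testVec (numLevels n M) v ≠ 0 ∧
      (ℓ : ℝ) * (testVec (numLevels n M) v ⬝ᵥ testVec (numLevels n M) v)
        ≤ testVec (numLevels n M) v ⬝ᵥ (knnBlock n M (η : ℝ) *ᵥ testVec (numLevels n M) v) := by
  unfold lowerOK at h
  simp only [Bool.and_eq_true, List.all_eq_true, List.mem_range, decide_eq_true_eq] at h
  obtain ⟨⟨⟨⟨hlen, hvnn⟩, hs⟩, hpos⟩, hray⟩ := h
  set m := numLevels n M with hm
  set y : Fin m → ℝ := testVec m v with hy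
  have hey : ∀ k, ext0 y k = (vecQ v k : ℝ) := by
    intro k; unfold ext0
    split_ifs with hk
    · rfl
    · rw [vecQ_of_le (by rw [hlen]; omega)]; simp
  have hyy : y ⬝ᵥ y = ((rsum (fun k => vecQ v k ^ 2) m : ℚ) : ℝ) := by
    rw [← sum_range_ext0_sq, rsum_eq]; push_cast
    apply Finset.sum_congr rfl; intro k _; rw [hey]
  refine ⟨?_, ?_⟩
  · intro h0
    have : y ⬝ᵥ y = 0 := by rw [h0, dotProduct_zero]
    rw [hyy] at this
    have : rsum (fun k => vecQ v k ^ 2) m = 0 := by exact_mod_cast this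
    linarith
  rw [hyy, knnBlock_eq_jac, jac_quadForm]
  have hcmp : ∀ k, k < m → ((pKQ n M η k * vecQ v k ^ 2 + 2 * (η / 4 * vecQ s k) * vecQ v k * vecQ v (k + 1) : ℚ) : ℝ)
      ≤ pK n M (η : ℝ) k * ext0 y k ^ 2 + 2 * cK n M (η : ℝ) k * ext0 y k * ext0 y (k + 1) := by
    intro k hk
    push_cast
    rw [cast_pKQ, hey, hey]
    have hsk := hs k hk
    have hs0 : (0 : ℝ) ≤ (vecQ s k : ℝ) := by exact_mod_cast hsk.1
    have hsle : (η : ℝ) / 4 * (vecQ s k : ℝ) ≤ cK n M (η : ℝ) k := by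
      unfold cK
      apply mul_le_mul_of_nonneg_left _ (by positivity)
      have h2 : ((vecQ s k : ℚ) : ℝ) ^ 2 ≤ bSq n M (lev n M k) * bSq n M (lev n M k + 1) := by
        rw [← cast_bSqQ, ← cast_bSqQ]; exact_mod_cast hsk.2
      calc ((vecQ s k : ℚ) : ℝ) = Real.sqrt (((vecQ s k : ℚ) : ℝ) ^ 2) := (Real.sqrt_sq hs0).symm
        _ ≤ Real.sqrt (bSq n M (lev n M k) * bSq n M (lev n M k + 1)) := Real.sqrt_le_sqrt h2
    have hvk : (0 : ℝ) ≤ (vecQ v k : ℝ) := by exact_mod_cast hvnn k hk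
    have hvk1 : (0 : ℝ) ≤ (vecQ v (k + 1) : ℝ) := by
      by_cases hk1 : k + 1 < m
      · exact_mod_cast hvnn (k + 1) hk1
      · rw [vecQ_of_le (by rw [hlen]; omega)]; simp
    have : 2 * ((η : ℝ) / 4 * (vecQ s k : ℝ)) * (vecQ v k : ℝ) * (vecQ v (k + 1) : ℝ)
        ≤ 2 * cK n M (η : ℝ) k * (vecQ v k : ℝ) * (vecQ v (k + 1) : ℝ) := by
      have hvv : 0 ≤ (vecQ v k : ℝ) * (vecQ v (k + 1) : ℝ) := mul_nonneg hvk hvk1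
      nlinarith
    linarith
  have hsum : (((rsum (fun k => pKQ n M η k * vecQ v k ^ 2 + 2 * (η / 4 * vecQ s k) * vecQ v k * vecQ v (k + 1)) m
      : ℚ)) : ℝ) ≤ ∑ k ∈ range m, (pK n M (η : ℝ) k * ext0 y k ^ 2 + 2 * cK n M (η : ℝ) k * ext0 y k * ext0 y (k + 1)) := by
    rw [rsum_eq]; push_cast
    exact Finset.sum_le_sum fun k hk => by
      have := hcmp k (mem_range.mp hk); push_cast at this; exact this
  have hray' : ((ℓ : ℚ) : ℝ) * ((rsum (fun k => vecQ v k ^ 2) m : ℚ) : ℝ)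
      ≤ ((rsum (fun k => pKQ n M η k * vecQ v k ^ 2 + 2 * (η / 4 * vecQ s k) * vecQ v k * vecQ v (k + 1)) m : ℚ) : ℝ) := by
    exact_mod_cast hray
  linarith

/-! ## The interval argument -/

/-- **(S_M) on a whole interval from two endpoint certificates sharing the test vector.** [folklore] -/
theorem budgetCondition_of_endpoints {n M : ℕ} {a b ua ub la lb : ℚ} {v s : List ℚ} (ha : 0 ≤ a) (hab : a ≤ b)
    (hua : upperOK n (M : ℤ) a ua = true) (hub : upperOK n (M : ℤ) b ub = true)
    (hla : lowerOK n ((M : ℤ) + 1) a la v s = true) (hlb : lowerOK n ((M : ℤ) + 1) b lb v s = true)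
    (hba : ua - la ≤ budgetQ n M a) (hbb : ub - lb ≤ budgetQ n M b)
    {η : ℝ} (h1 : (a : ℝ) ≤ η) (h2 : η ≤ (b : ℝ)) : BudgetCondition n M η := by
  have hb0 : 0 ≤ b := ha.trans hab
  -- write η = t a + (1 − t) b with t ∈ [0,1]
  obtain ⟨t, ht0, ht1, hη⟩ : ∃ t : ℝ, 0 ≤ t ∧ t ≤ 1 ∧ η = t * a + (1 - t) * b := by
    by_cases heq : (a : ℝ) = b
    · exact ⟨0, le_rfl, zero_le_one, by rw [zero_mul, zero_add, sub_zero, one_mul]; linarith⟩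
    · have hlt : (a : ℝ) < b := lt_of_le_of_ne (by exact_mod_cast hab) heq
      refine ⟨((b : ℝ) - η) / (b - a), div_nonneg (by linarith) (by linarith),
        (div_le_one (by linarith)).mpr (by linarith), ?_⟩
      field_simp
      ring
  intro x x' hx hx'
  have hxx := dotProduct_self_pos_of_ne_zero hx.1
  -- upper: Rayleigh(x) ≤ t ua + (1−t) ub
  have hup : rayleigh (knnBlock n (M : ℤ) η) x ≤ t * ua + (1 - t) * ub := by
    rw [rayleigh, div_le_iff₀ hxx, hη, quadForm_knnBlock_affine]
    have e1 := quadForm_le_of_upperOK hua x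
    have e2 := quadForm_le_of_upperOK hub x
    nlinarith [mul_le_mul_of_nonneg_left e1 ht0, mul_le_mul_of_nonneg_left e2 (by linarith : (0:ℝ) ≤ 1 - t)]
  -- lower: Rayleigh(x') ≥ t la + (1−t) lb via the shared test vector
  obtain ⟨hy0, hya⟩ := testVec_of_lowerOK ha hla
  obtain ⟨_, hyb⟩ := testVec_of_lowerOK hb0 hlb
  set y := testVec (numLevels n ((M : ℤ) + 1)) v
  have hlow : t * la + (1 - t) * lb ≤ rayleigh (knnBlock n ((M : ℤ) + 1) η) x' := by
    apply le_rayleigh_of_testVector hx' hy0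
    rw [hη, quadForm_knnBlock_affine]
    nlinarith [mul_le_mul_of_nonneg_left hya ht0, mul_le_mul_of_nonneg_left hyb (by linarith : (0:ℝ) ≤ 1 - t)]
  -- budget
  have hbud : budget n M η = t * budget n M (a : ℝ) + (1 - t) * budget n M (b : ℝ) := by rw [hη, budget_affine]
  have hba' : ((ua : ℝ)) - la ≤ budget n M (a : ℝ) := by rw [← cast_budgetQ]; exact_mod_cast hba
  have hbb' : ((ub : ℝ)) - lb ≤ budget n M (b : ℝ) := by rw [← cast_budgetQ]; exact_mod_cast hbb
  rw [hbud]
  nlinarith [mul_le_mul_of_nonneg_left hba' ht0, mul_le_mul_of_nonneg_left hbb' (by linarith : (0:ℝ) ≤ 1 - t)]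

/-! ## Interval certificate tables -/

/-- an interval record `(n, M, [a, b], ua, ub, la, lb, v, s)`. [folklore] -/
structure ICert where
  /-- `n = 2s` -/
  n : ℕ
  /-- sector `M ≥ 0` -/
  M : ℕ
  /-- left end of the `η`-interval -/
  a : ℚ
  /-- right end of the `η`-interval -/
  b : ℚ
  /-- upper bound for `λ_max(P_M)` at `a` -/
  ua : ℚ
  /-- … at `b` -/
  ub : ℚ
  /-- lower bound for `λ_max(P_{M+1})` at `a` -/
  la : ℚ
  /-- … at `b` -/
  lb : ℚ
  /-- shared test vector -/
  v : List ℚ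
  /-- shared square-root minorants -/
  s : List ℚ

/-- an interval record passes: both endpoint certificates and both budget inequalities. [folklore] -/
def ICert.ok (c : ICert) : Bool :=
  decide (0 ≤ c.a) && decide (c.a ≤ c.b)
  && upperOK c.n (c.M : ℤ) c.a c.ua && upperOK c.n (c.M : ℤ) c.b c.ub
  && lowerOK c.n ((c.M : ℤ) + 1) c.a c.la c.v c.s && lowerOK c.n ((c.M : ℤ) + 1) c.b c.lb c.v c.s
  && decide (c.ua - c.la ≤ budgetQ c.n c.M c.a) && decide (c.ub - c.lb ≤ budgetQ c.n c.M c.b)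

/-- soundness of one record. [folklore] -/
theorem budgetCondition_of_ICert_ok {c : ICert} (h : c.ok = true) {η : ℝ} (h1 : (c.a : ℝ) ≤ η) (h2 : η ≤ (c.b : ℝ)) :
    BudgetCondition c.n c.M η := by
  unfold ICert.ok at h
  simp only [Bool.and_eq_true, decide_eq_true_eq] at h
  obtain ⟨⟨⟨⟨⟨⟨⟨ha, hab⟩, hua⟩, hub⟩, hla⟩, hlb⟩, hba⟩, hbb⟩ := h
  exact budgetCondition_of_endpoints ha hab hua hub hla hlb hba hbb h1 h2

/-- greedy coverage: starting from `r`, extend to the right through intervals `(a, b)` with `a ≤ r`. [folklore] -/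
def reach (r : ℚ) : List (ℚ × ℚ) → ℚ
  | [] => r
  | (a, b) :: rest => if a ≤ r then reach (max r b) rest else r

/-- every point strictly beyond the start and up to `reach` lies in one of the intervals. [folklore] -/
theorem exists_mem_of_le_reach (L : List (ℚ × ℚ)) :
    ∀ (r : ℚ) (η : ℝ), (r : ℝ) < η → η ≤ (reach r L : ℝ) → ∃ ab ∈ L, ((ab.1 : ℚ) : ℝ) ≤ η ∧ η ≤ ((ab.2 : ℚ) : ℝ) := by
  induction L with
  | nil => intro r η h1 h2; simp [reach] at h2; linarith
  | cons ab rest ih =>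
    intro r η h1 h2
    obtain ⟨a, b⟩ := ab
    simp only [reach] at h2
    split_ifs at h2 with har
    · by_cases hηb : η ≤ (b : ℝ)
      · exact ⟨(a, b), List.mem_cons_self, by push_cast; constructor <;> [exact (by exact_mod_cast har : (a:ℝ) ≤ r).trans h1.le; exact hηb]⟩
      · have hlt : ((max r b : ℚ) : ℝ) < η := by
          push_cast; exact max_lt h1 (lt_of_not_ge hηb)
        obtain ⟨ab', hmem, hab'⟩ := ih (max r b) η hlt h2
        exact ⟨ab', List.mem_cons_of_mem _ hmem, hab'⟩
    · linarith

/-- the records of the table for `(n, M)`, as intervals. [folklore] -/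
def intervalsOf (certs : List ICert) (n M : ℕ) : List (ℚ × ℚ) :=
  (certs.filter fun c => c.n == n && c.M == M).map fun c => (c.a, c.b)

/-- **table check:** all records pass, and for every `(n, M)` with `lo ≤ n ≤ hi`, `M + 4 ≤ n` the records cover `[elo, ehi]`.
[folklore] -/
def icertsOK (elo ehi : ℚ) (lo hi : ℕ) (certs : List ICert) : Bool :=
  certs.all ICert.ok
  && (List.range (hi + 1)).all fun n => decide (n < lo) || (List.range (n - 3)).all fun M =>
    decide (ehi ≤ reach elo (intervalsOf certs n M))
    && (intervalsOf certs n M).any fun ab => decide (ab.1 ≤ elo) && decide (elo ≤ ab.2)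

/-- **soundness of an interval table:** (S_M) for every `lo ≤ n ≤ hi`, `M + 4 ≤ n` and every real `η ∈ [elo, ehi]`. [folklore] -/
theorem budgetCondition_of_icertsOK {elo ehi : ℚ} {lo hi : ℕ} {certs : List ICert}
    (h : icertsOK elo ehi lo hi certs = true) {n M : ℕ} (hlo : lo ≤ n) (hhi : n ≤ hi) (hM : M + 4 ≤ n)
    {η : ℝ} (h1 : (elo : ℝ) ≤ η) (h2 : η ≤ (ehi : ℝ)) : BudgetCondition n M η := by
  unfold icertsOK at h
  rw [Bool.and_eq_true, List.all_eq_true, List.all_eq_true] at h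
  obtain ⟨hall, hcov⟩ := h
  have hn := hcov n (List.mem_range.mpr (by omega))
  rw [Bool.or_eq_true, decide_eq_true_eq, List.all_eq_true] at hn
  rcases hn with hn | hn
  · omega
  have hm := hn M (List.mem_range.mpr (by omega))
  rw [Bool.and_eq_true, decide_eq_true_eq, List.any_eq_true] at hm
  obtain ⟨hreach, ⟨ab0, hab0mem, hab0⟩⟩ := hm
  rw [Bool.and_eq_true, decide_eq_true_eq, decide_eq_true_eq] at hab0
  -- pick the covering record
  have key : ∃ ab ∈ intervalsOf certs n M, ((ab.1 : ℚ) : ℝ) ≤ η ∧ η ≤ ((ab.2 : ℚ) : ℝ) := by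
    rcases eq_or_lt_of_le h1 with heq | hlt
    · exact ⟨ab0, hab0mem, by rw [← heq]; exact_mod_cast hab0.1, by rw [← heq]; exact_mod_cast hab0.2⟩
    · exact exists_mem_of_le_reach _ elo η hlt (h2.trans (by exact_mod_cast hreach))
  obtain ⟨ab, habmem, hab1, hab2⟩ := key
  unfold intervalsOf at habmem
  rw [List.mem_map] at habmem
  obtain ⟨c, hcmem, hcab⟩ := habmem
  rw [List.mem_filter] at hcmem
  obtain ⟨hcin, hcnm⟩ := hcmem
  simp only [Bool.and_eq_true, beq_iff_eq] at hcnm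
  obtain ⟨hcn, hcM⟩ := hcnm
  have hok : c.ok = true := hall c hcin
  have := budgetCondition_of_ICert_ok hok (η := η) (by rw [← hcab] at hab1; exact hab1) (by rw [← hcab] at hab2; exact hab2)
  rw [hcn, hcM] at this
  exact this

/-- **`XYLiebMattisKnn n Δ` on a whole `Δ`-interval from an interval table** (`4 ≤ n ≤ hi`, `1 − Δ ∈ [elo, ehi]`, `elo > 0`). [folklore] -/
theorem xyLiebMattisKnn_of_icertsOK {elo ehi : ℚ} {hi : ℕ} {certs : List ICert} (h : icertsOK elo ehi 4 hi certs = true)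
    (helo : 0 < elo) {n : ℕ} (hn : n ≤ hi) {Δ : ℝ} (h1 : (elo : ℝ) ≤ 1 - Δ) (h2 : 1 - Δ ≤ (ehi : ℝ)) :
    XYLiebMattisKnn n Δ := by
  have helo' : (0 : ℝ) < elo := by exact_mod_cast helo
  apply xyLiebMattisKnn_of_budgets (by linarith)
  intro M hM
  exact budgetCondition_of_icertsOK h (by omega) hn hM h1 h2

end Summit.HubbardSuperconductivity.HubbardSuperconductivity.Theorems.AnisotropyChord.Knn
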